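import Summits.QuantumFields.YangMills.Theorems.BalabanUVNodesN22AtRecordOfKernelFading
import Summits.QuantumFields.YangMills.Theorems.BalabanUVNodesN22WindowedNE9DichotomyEHolo
import Summits.QuantumFields.BalabanUV.T4Continuum.Spine.NE1p.DressedOutputAnalyticFaces

/-!
# BalabanUVNodes ∕ node N22 = NE9 — «J33-3 AT THE RECORD» REPAIRED: K3⁷ v5 §2b's `h9` WITH THE RECORD's GEOMETRIC MODULI from node N18's kernel step rate + OLDER-coordinate
# ACTIVITY margins with ONE radius (node N10's T-row complexified in the older couplings — print's dichotomy, [II] p. 12 (2.3)) + node N09's `EHoloAt` families for the LAST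
# coupling + readings ∕ tails ∕ W1-20's law ∕ (1.21) — NO age-growing radii (module J37 §3), the geometric gain being node N18's (modules J38–J41)

Cell `pub-ymgap`, HUMAN RULING D-0062 (Track A), R134 seat `pub-ymgap-dag-n22-c` (strategy s1), generation 14, module J43.  THEOREMS ONLY (no `def`, no `sorry`, standard axioms);
`--kind proof --supports stmt-QuantumFields-20544 --as helper` (K3⁷ `SpineGivenEndpointR13SepCoPH`, skeleton v5 941dddb108cb), COUNT-NEUTRAL.  Imports J40
`…Theorems.BalabanUVNodesN22AtRecordOfKernelFading`, J33 part 3 `…Theorems.BalabanUVNodesN22WindowedNE9DichotomyEHolo` (`lastOutputHolo_of_eHoloAt`) and the gaps cell's S25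
`Spine.NE1p.DressedOutputAnalyticFaces` (`analytic_and_bounded_locE_param_torus`: the PARAMETRIC Kotecký–Preiss engine on the four-torus).  Nothing re-declared.

THE POINT.  dag-n22-w5's «J33-3 at the record» (p613896-class ∕ `…AtRecordOfStepSchemas` §1) junctions an AGE-parametrised activity-margin table `c₀·4A∕ϱt n i` into `ℓ.moduli`; module
J37 §3: that row forces `ϱt n i → ∞` with the age.  THIS FILE reads the SAME activity-level datum with ONE radius `ϱ` and gets `h9` through the kernel-fading road instead:
* §1 ★ `outputCoordHolo_of_activityCoordHolo` — ACTIVITY ⟹ OUTPUT coupling holomorphy at one step: if every activity `t ↦ H(Z; g|g_i := t; φ)`, `Z ⊆ X`, extends holomorphically to a set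
  containing the closed `ϱ`-discs about `]0, γ]` with (2.38) `‖·‖ ≤ A e^{−R d(Z)}` THERE, then (Road 1's numerals) the (2.13) term `t ↦ E^{(k+1)}(X; g|g_i := t; φ)` extends
  holomorphically to the open `ϱ`-neighbourhood of `]0, γ]` (so to a set containing the closed `ϱ∕2`-discs) with `‖·‖ ≤ e·9·64·K₀(64,8)²·A·e^{−r₁ d(X)}` — the cluster expansion is
  analytic in its activities (`analytic_and_bounded_locE_param_torus` at the parameter space `ℂ`; `ClusterStep.E_eq_locE`, `B13Resummation.locE_congr`).
* §2 ★ `outputCoordHolo_of_olderActivityCoordHolo_eHoloAt` — THE DICHOTOMY ASSEMBLED AT ONE RADIUS: older coordinates `i < k` by §1 from the activity margins, the last coordinate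
  `i = k` by J33-3's `lastOutputHolo_of_eHoloAt` from node N09's `EHoloAt` family; common radius `ρ₀ ≤ ϱ∕2, r_E`, common letter `B ≥ e·9·64·K₀²·A, E₀`, common rate `κ_E ≤ r₁, cs.κ` —
  J40's `hL` at the space tables `{φ | ∀ Z ⊆ X, φ ∈ U^c_{k+1}(Z, cs.α₀, cs.α₁)}`.
* §3 ★★★ `ne9_EA_objectsOfRecord₁₃_of_kernelStepRate_olderActivityCoordHolo_eHoloAt` — v5 §2b's `h9` with `ℓ.moduli` from node N18's letter + §2's inputs + readings (the
  per-sub-polymer space clause of J33) ∕ tails ∕ law ∕ (1.21) + rows (J40 §2′); ★★★ the pin face.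

HONEST FRAMING (binding).  Count-neutral COMPOSITION; NO estimate of Bałaban's is proved or asserted; displayed with owners: the older-coordinate activity margins with (2.38) on the
complex discs (node N10's T-row complexified in the older couplings — no cut-off is met there, [II] p. 12 (2.3); NOT a printed display ∕ NODE A at the towers of record), the
`EHoloAt` families (N09), Road 1's numerals, node N18's kernel step rate (N18; NE5 NOT PRINTED for d = 4), readings ∕ term holomorphy through them ∕ tails (NODE A ∕ N09), the law
(def-W1 ∕ NODE A), (1.21) (dag-n22-w3's road); nothing of the record is constructed or claimed to meet them; N22 is NOT discharged (typed 28∕28 · discharged 5∕27 UNCHANGED); K3⁷ OPEN and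
NOT claimed; NE9 is NOT IN PRINT for d = 4; no count claim; one finite 𝕋⁴ programme at fixed ε — R4 closes the CONDITIONAL rung `BalabanLadder.UV` only; NOTHING about the continuum
limit, ℝ⁴, infinite volume, OS axioms, a mass gap or the Clay problem is proved or claimed.  References (TYPES only): [I] = Bałaban, CMP 109 (1987) Thm 1 p. 259, (1.7) p. 261, §1 p. 263
with (1.18), (1.20)–(1.22) p. 264, §2 p. 266, p. 282, (5.10) p. 293; [II] = CMP 116 (1988) (2.3) p. 12, (2.13)–(2.14) pp. 14–15, Lemma 3 (2.38) p. 20, (2.39)–(2.41) p. 21.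
-/

noncomputable section

open Filter Topology Set Metric
open scoped BigOperators

namespace YMDAG.N22.KernelFading

open Literature.MathematicalPhysics.QuantumFieldTheory.Balaban1983to89
open Literature.MathematicalPhysics.QuantumFieldTheory.Balaban1983to89.T4Continuum (T4Family ULoop)
open Literature.MathematicalPhysics.QuantumFieldTheory.Balaban1983to89.T4OutputRate (Window NE9)
open Literature.MathematicalPhysics.QuantumFieldTheory.Balaban1983to89.TreeLengthTorus (TPt tsys torusTreeLen torusTreeLen_nonneg)
open Literature.MathematicalPhysics.QuantumFieldTheory.Balaban1983to89.TreeLengthTorusGeometry (TTouch)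
open Literature.MathematicalPhysics.QuantumFieldTheory.Balaban1983to89.B12TreeDecay (K₀ kappa₀ K₀_pos)
open Literature.MathematicalPhysics.QuantumFieldTheory.Balaban1983to89.B12Decay510 (delta1)
open Literature.MathematicalPhysics.QuantumFieldTheory.Balaban1983to89.B12Decay510Window (K₁)
open Literature.MathematicalPhysics.QuantumFieldTheory.Balaban1983to89.B12Decay510Torus (distCT nearT)
open Literature.MathematicalPhysics.QuantumFieldTheory.Balaban1983to89.B12BetaHolo (EHoloAt)
open Literature.MathematicalPhysics.QuantumFieldTheory.Balaban1983to89.B13Resummation (locE locE_congr)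
open Literature.MathematicalPhysics.QuantumFieldTheory.Balaban1983to89.Step (SFConsts)
open Literature.MathematicalPhysics.QuantumFieldTheory.Balaban1983to89.Node00
open Literature.MathematicalPhysics.QuantumFieldTheory.Balaban1983to89.Node00.Sect2 (domSys domCount CPair spaceI domSites Setting Residual)
open Literature.MathematicalPhysics.QuantumFieldTheory.Balaban1983to89.Node00.W1
open Literature.MathematicalPhysics.QuantumFieldTheory.Balaban1983to89.Node00.LocalizedSum17 (localizedSum ReadingMaps Localizes17OfRecord₁₃)
open Literature.MathematicalPhysics.QuantumFieldTheory.Balaban1983to89.Node00.U3OfKernels (histPrefix objectsOfRecord₁₃)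
open Literature.MathematicalPhysics.QuantumFieldTheory.Balaban1983to89.Node00.U3KernelLetters (KernelStepRateOfRecord₁₃ PolLimitsExistOfRecord₁₃)
open YMDAG.UVSplit (N22At RateReading₁₃CoPH rateCarriersOfRecord₁₃CoPH)
open YMDAG.N22.AtKernels (n22At_rateCarriers_of_kernels_pin_of_ne9)
open YMDAG.N22.Dichotomy (lastOutputHolo_of_eHoloAt)
open Summit.QuantumFields.BalabanUV.T4Continuum.NE1p.DressedOutputAnalyticFaces (analytic_and_bounded_locE_param_torus)

open scoped Matrix.Norms.L2Operator

/-! ## §1 ACTIVITY ⟹ OUTPUT coupling holomorphy at one step (the cluster expansion is analytic in its activities) -/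

section Step

variable (F : T4Family) (K : ℕ) {𝔸 : Type*} {M : ℕ} {k : ℕ}

open Classical in
/-- ★ **OUTPUT-LEVEL COUPLING HOLOMORPHY FROM ACTIVITY-LEVEL COUPLING HOLOMORPHY WITH (2.38) ON THE DISCS.**  For W1's one-step data `S` at level `k`, a coordinate `i`, a radius
`ϱ > 0` and space tables `sp`: IF for every box prefix `g`, polymer `Z` and configuration `φ ∈ sp Z` the activity `t ↦ H(Z; g|g_i := t; φ)` extends to a holomorphic `Hc` on a set
containing the closed `ϱ`-discs about `]0, γ]` with `‖Hc‖ ≤ A·e^{−R d_{k+1}(Z)}` there (the (2.38) majorant on the complex discs), and Road 1's numerals hold (`0 ≤ A`, `0 ≤ r₁`,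
`r₁ + 128 log 162 + 2 ≤ R`, `A·e^{5r₁+1}·K₀(64,8)·9·64 ≤ 1`), THEN for every `g`, domain `X` and configuration `φ` admissible for EVERY sub-polymer of `X` the (2.13) term
`t ↦ E^{(k+1)}(X; g|g_i := t; φ)` extends to a function holomorphic on the open `ϱ`-neighbourhood `D` of `]0, γ]` — which contains the closed `ϱ∕2`-discs — with
`‖·‖ ≤ e·9·64·K₀(64,8)²·A·e^{−r₁ d_{k+1}(X)}` on `D`: S25's parametric Kotecký–Preiss engine `analytic_and_bounded_locE_param_torus` at the parameter space `ℂ` and the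
activity family `t ↦ (Z ↦ Hc_Z(t))`, `ClusterStep.E_eq_locE` by `rfl`, `locE_congr` at real `t`. [folklore] -/
theorem outputCoordHolo_of_activityCoordHolo (S : ClusterStep (F.P K) 𝔸 M k) (sp : (domSys (F.P K) M (k + 1)).Dom → Set (CPair (F.P K) 𝔸))
    {γ ϱ A R r₁ : ℝ} (hϱ : 0 < ϱ) (hA : 0 ≤ A) (hr₁ : 0 ≤ r₁) (hrate : r₁ + 2 * (64 * Real.log 162) + 2 ≤ R) (hsmall : A * Real.exp (5 * r₁ + 1) * K₀ 64 8 * 9 * 64 ≤ 1)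
    (i : Fin (k + 1))
    (hO : ∀ g ∈ box γ k, ∀ (Z : (domSys (F.P K) M (k + 1)).Dom), ∀ φ ∈ sp Z,
      ∃ (Hc : ℂ → ℂ) (O : Set ℂ), DifferentiableOn ℂ Hc O ∧ (∀ t ∈ Ioc (0 : ℝ) γ, closedBall (t : ℂ) ϱ ⊆ O) ∧
        (∀ z ∈ O, ‖Hc z‖ ≤ A * Real.exp (-(R * (domSys (F.P K) M (k + 1)).dj Z))) ∧
        (∀ t ∈ Ioc (0 : ℝ) γ, Hc t = S.H (Function.update g i t) φ Z)) :
    ∀ g ∈ box γ k, ∀ (X : (domSys (F.P K) M (k + 1)).Dom) (φ : CPair (F.P K) 𝔸), (∀ Z : (domSys (F.P K) M (k + 1)).Dom, Z.1 ⊆ X.1 → φ ∈ sp Z) →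
      ∃ (Ec : ℂ → ℂ) (O : Set ℂ), DifferentiableOn ℂ Ec O ∧ (∀ t ∈ Ioc (0 : ℝ) γ, closedBall (t : ℂ) (ϱ / 2) ⊆ O) ∧
        (∀ z ∈ O, ‖Ec z‖ ≤ Real.exp 1 * 9 * 64 * K₀ 64 8 ^ 2 * A * Real.exp (-(r₁ * (domSys (F.P K) M (k + 1)).dj X))) ∧
        (∀ t ∈ Ioc (0 : ℝ) γ, Ec t = S.E (Function.update g i t) φ X) := by
  intro g hg X φ hφ
  -- choose the activity extensions of the sub-polymers of `X`
  have hO' : ∀ Z : (domSys (F.P K) M (k + 1)).Dom, Z.1 ⊆ X.1 →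
      ∃ (Hc : ℂ → ℂ) (O : Set ℂ), DifferentiableOn ℂ Hc O ∧ (∀ t ∈ Ioc (0 : ℝ) γ, closedBall (t : ℂ) ϱ ⊆ O) ∧
        (∀ z ∈ O, ‖Hc z‖ ≤ A * Real.exp (-(R * (domSys (F.P K) M (k + 1)).dj Z))) ∧
        (∀ t ∈ Ioc (0 : ℝ) γ, Hc t = S.H (Function.update g i t) φ Z) := fun Z hZ => hO g hg Z φ (hφ Z hZ)
  choose Hc O hhol hball hbd heq using hO'
  -- the common open domain: the open `ϱ`-neighbourhood of `]0, γ]`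
  set D : Set ℂ := ⋃ t ∈ Ioc (0 : ℝ) γ, ball (t : ℂ) ϱ with hD
  have hDopen : IsOpen D := isOpen_biUnion fun _ _ => isOpen_ball
  have hDO : ∀ (Z : (domSys (F.P K) M (k + 1)).Dom) (hZ : Z.1 ⊆ X.1), D ⊆ O Z hZ := fun Z hZ =>
    iUnion₂_subset fun t ht => ball_subset_closedBall.trans (hball Z hZ t ht)
  -- the complexified activity family on `D`
  set act : ℂ → (domSys (F.P K) M (k + 1)).Dom → ℂ := fun w Z => if hZ : Z.1 ⊆ X.1 then Hc Z hZ w else 0 with hact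
  have hholD : ∀ Z : (domSys (F.P K) M (k + 1)).Dom, Z.1 ⊆ X.1 → DifferentiableOn ℂ (fun w => act w Z) D := by
    intro Z hZ
    have e : (fun w => act w Z) = Hc Z hZ := funext fun w => by simp only [hact, dif_pos hZ]
    rw [e]; exact (hhol Z hZ).mono (hDO Z hZ)
  have hm : ∀ w ∈ D, ∀ Z : (domSys (F.P K) M (k + 1)).Dom, Z.1 ⊆ X.1 → ‖act w Z‖ ≤ A * Real.exp (-(R * torusTreeLen Z.1)) := by
    intro w hw Z hZ
    simp only [hact, dif_pos hZ]
    exact hbd Z hZ w (hDO Z hZ hw)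
  obtain ⟨hdiff, hbdE⟩ := analytic_and_bounded_locE_param_torus (N := domCount (F.P K) M (k + 1)) (P := ℂ)
    (m := fun Z : (tsys 4 (domCount (F.P K) M (k + 1))).Dom => A * Real.exp (-(R * torusTreeLen Z.1))) (act := act)
    (A := A) (R := R) (r₁ := r₁) X hDopen hA hr₁ hrate hsmall hholD hm (fun _ _ => le_rfl)
  refine ⟨fun w => locE (TTouch (d := 4) (N := domCount (F.P K) M (k + 1))) (fun Z : (domSys (F.P K) M (k + 1)).Dom => Z.1) (act w) X.1, D, hdiff,
    fun t ht => ?_, hbdE, fun t ht => ?_⟩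
  · -- the closed `ϱ∕2`-disc about `t` lies in the open `ϱ`-ball about `t`
    exact (closedBall_subset_ball (by linarith)).trans (subset_iUnion₂ (s := fun t' (_ : t' ∈ Ioc (0 : ℝ) γ) => ball (t' : ℂ) ϱ) t ht)
  · -- at a real coupling the family IS the activity family of the updated prefix
    rw [ClusterStep.E_eq_locE]
    refine locE_congr _ fun Z hZ => ?_
    show act (t : ℂ) Z = S.H (Function.update g i t) φ Z
    simp only [hact, dif_pos hZ]
    exact heq Z hZ t ht

end Step

/-! ## §2 The dichotomy assembled at ONE radius: older coordinates from the activity margins, the last from node N09's `EHoloAt` family -/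

section Tower

variable (F : T4Family) (K : ℕ) {𝔸 : Type*} [NormedRing 𝔸] [NormedAlgebra ℂ 𝔸] [CompleteSpace 𝔸] {G : Type*} [GaugeGroup G] {M : ℕ}
  (Sg : Setting 𝔸 G) (Rz : Residual (F.P K) 𝔸) (logZ : ℕ → GaugeField (F.P K) 0 G → ℝ) (β : ℕ → ℝ → ℝ)

open Classical in
/-- ★ **J40's MARGIN DATUM `hL` WITH ONE RADIUS FROM THE DICHOTOMY.**  At one torus, for the tower `S` at the space tables of record `U^c_{k+1}(·, cs.α₀, cs.α₁)`: older coordinates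
`i < k` from the ACTIVITY margins (radius `ϱ`, (2.38) letters `(A, R)`, Road 1's numerals; §1), the last coordinate `i = k` from node N09's `EHoloAt (sfTowerOfRecord …) cs k` family
with uniform letters `(E₀, r_E)` (`γ ≤ cs.γ`; J33-3 `lastOutputHolo_of_eHoloAt`); common radius `ρ₀` (`ρ₀ ≤ ϱ∕2`, `ρ₀ ≤ r_E`), common letter `B` (`e·9·64·K₀²·A ≤ B`, `E₀ ≤ B`),
common rate `κ_E` (`κ_E ≤ r₁`, `κ_E ≤ cs.κ`), at the space tables `{φ | ∀ Z ⊆ X, φ ∈ U^c_{k+1}(Z)}`. [folklore] -/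
theorem outputCoordHolo_of_olderActivityCoordHolo_eHoloAt (S : ClusterTower (F.P K) 𝔸 M) {cs : SFConsts} {γ ϱ A R r₁ rE E₀ ρ₀ B κE : ℝ}
    (hγ : γ ≤ cs.γ) (hϱ : 0 < ϱ) (hA : 0 ≤ A) (hr₁ : 0 ≤ r₁) (hrate : r₁ + 2 * (64 * Real.log 162) + 2 ≤ R)
    (hsmall : A * Real.exp (5 * r₁ + 1) * K₀ 64 8 * 9 * 64 ≤ 1)
    (hρ₀ϱ : ρ₀ ≤ ϱ / 2) (hρ₀E : ρ₀ ≤ rE) (hBA : Real.exp 1 * 9 * 64 * K₀ 64 8 ^ 2 * A ≤ B) (hBE : E₀ ≤ B) (hκr : κE ≤ r₁) (hκc : κE ≤ cs.κ)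
    (hO : ∀ (k : ℕ), ∀ g ∈ box γ k, ∀ (Z : (domSys (F.P K) M (k + 1)).Dom),
      ∀ φ ∈ spaceI Sg Rz M (k + 1) (domSites (F.P K) M (k + 1) Z) cs.α₀ cs.α₁, ∀ i : Fin (k + 1), (i : ℕ) < k →
      ∃ (Hc : ℂ → ℂ) (O : Set ℂ), DifferentiableOn ℂ Hc O ∧ (∀ t ∈ Ioc (0 : ℝ) γ, closedBall (t : ℂ) ϱ ⊆ O) ∧
        (∀ z ∈ O, ‖Hc z‖ ≤ A * Real.exp (-(R * (domSys (F.P K) M (k + 1)).dj Z))) ∧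
        (∀ t ∈ Ioc (0 : ℝ) γ, Hc t = (S k).H (Function.update g i t) φ Z))
    (hE : ∀ g ∈ Window γ, ∀ k : ℕ, ∃ H : EHoloAt (sfTowerOfRecord Sg Rz M S ⟨g, β⟩ logZ) cs k, H.E₀ ≤ E₀ ∧ rE ≤ H.r) (k : ℕ) (i : Fin (k + 1)) :
    ∀ g ∈ box γ k, ∀ (X : (domSys (F.P K) M (k + 1)).Dom),
      ∀ φ ∈ {φ : CPair (F.P K) 𝔸 | ∀ Z : (domSys (F.P K) M (k + 1)).Dom, Z.1 ⊆ X.1 → φ ∈ spaceI Sg Rz M (k + 1) (domSites (F.P K) M (k + 1) Z) cs.α₀ cs.α₁},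
      ∃ (Ec : ℂ → ℂ) (O : Set ℂ), DifferentiableOn ℂ Ec O ∧ (∀ t ∈ Ioc (0 : ℝ) γ, closedBall (t : ℂ) ρ₀ ⊆ O) ∧
        (∀ z ∈ O, ‖Ec z‖ ≤ B * Real.exp (-(κE * (domSys (F.P K) M (k + 1)).dj X))) ∧
        (∀ t ∈ Ioc (0 : ℝ) γ, Ec t = (S k).E (Function.update g i t) φ X) := by
  intro g hg X φ hφ
  have hd : 0 ≤ (domSys (F.P K) M (k + 1)).dj X := torusTreeLen_nonneg _
  -- weakening of a bound `C e^{−κ' d}` with `C ≤ B`, `κ_E ≤ κ'`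
  have weaken : ∀ {C κ' : ℝ}, C ≤ B → κE ≤ κ' → ∀ x : ℝ, x ≤ C * Real.exp (-(κ' * (domSys (F.P K) M (k + 1)).dj X)) →
      x ≤ B * Real.exp (-(κE * (domSys (F.P K) M (k + 1)).dj X)) := by
    intro C κ' hC hκ x hx
    have hB0 : 0 ≤ B := (le_trans (by positivity) hBA)
    refine hx.trans ((mul_le_mul_of_nonneg_right hC (Real.exp_nonneg _)).trans (mul_le_mul_of_nonneg_left ?_ hB0))
    exact Real.exp_le_exp.2 (neg_le_neg (mul_le_mul_of_nonneg_right hκ hd))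
  by_cases hik : (i : ℕ) < k
  · -- an OLDER coordinate: §1 from the activity margins
    obtain ⟨Ec, O, hhol, hball, hbd, heq⟩ := outputCoordHolo_of_activityCoordHolo F K (S k)
      (fun Z => spaceI Sg Rz M (k + 1) (domSites (F.P K) M (k + 1) Z) cs.α₀ cs.α₁) hϱ hA hr₁ hrate hsmall i
      (fun g hg Z φ hφ => hO k g hg Z φ hφ i hik) g hg X φ hφ
    exact ⟨Ec, O, hhol, fun t ht => (closedBall_subset_closedBall hρ₀ϱ).trans (hball t ht), fun z hz => weaken hBA hκr _ (hbd z hz), heq⟩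
  · -- the LAST coordinate: node N09's `EHoloAt` family (J33 part 3)
    have hi : i = Fin.last k := by
      refine Fin.ext ?_
      rw [Fin.val_last]
      have := i.isLt
      omega
    obtain ⟨Ec, O, hhol, hball, hbd, heq⟩ := lastOutputHolo_of_eHoloAt F K Sg Rz logZ β S hγ hE k g hg X φ (hφ X subset_rfl)
    refine ⟨Ec, O, hhol, fun t ht => (closedBall_subset_closedBall hρ₀E).trans (hball t ht), fun z hz => weaken hBE hκc _ (hbd z hz), fun t ht => ?_⟩
    rw [heq t ht, hi]

end Tower

/-! ## §3 ★★★ AT THE RECORD: `h9` with the record's geometric moduli from node N18's letter + the dichotomy's inputs at ONE radius -/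

section Record

variable (F : T4Family) (N : ℕ) [NeZero N]

open Classical in
/-- ★★★ **«J33-3 AT THE RECORD» REPAIRED — v5 §2b's `h9` WITH THE RECORD's GEOMETRIC MODULI FROM NODE N18's KERNEL STEP RATE + OLDER ACTIVITY MARGINS WITH ONE RADIUS + NODE N09's
`EHoloAt` FAMILIES, NO age-parametrised table.**  Towers `S K` read through `emb` with W1-20's law at the space tables of record; per `(K, k)`: the OLDER-coordinate activity margin datum
(radius `ϱ`, (2.38) letters `(A, R)` on the complex discs — node N10's T-row complexified in the older couplings ∕ NODE A), Road 1's numerals; node N09's `EHoloAt` family per torus,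
window history and step with uniform letters `(E₀, r_E)` (`θ.γ ≤ cs.γ`); common letters `ρ₀, B, κ_E` as in §2; complexified probe readings `Φ K k X` on open `U K k X ⊇ ball 0 r` mapping
the ball into the space of EVERY sub-polymer of `X` (J33's clause) and making the term holomorphic at every window history; site weights with tails; `δ₀ > 0`, `2κ₀(64,8) ≤ κ_w ≤ κ_E`;
`PolLimitsExistOfRecord₁₃`; node N18's `KernelStepRateOfRecord₁₃ F N θ κ₅ ℓ.θ₅ C₅`; rows `δ₁ ≤ κ₅`, `0 < ℓ.ω`, `ℓ.θ₅ ≤ ℓ.ω²`, `ℓ.κ ≤ δ₁`, `(4·(2C₅∕(1−θ₅) + 2E₁)∕γ + C₂γ∕2)∕ℓ.ω ≤ ℓ.C₉`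
(`E₁ = (16BB₃²∕r²)eK₀K₁`, `C₂ = (16·(64B∕ρ₀²)·B₃²∕r²)eK₀K₁`, `e = e^{12Mδ₁}`, `δ₁ = ½min{δ₀, κ_w(4M)⁻¹}`) ⟹ **`NE9 ((objectsOfRecord₁₃ F N θ ℓ).EA 0) (Window θ.γ) ℓ.κ ℓ.moduli`** — §2
into J40 §2′.  LOCATED (hypothesis form); N22 NOT discharged. [folklore] -/
theorem ne9_EA_objectsOfRecord₁₃_of_kernelStepRate_olderActivityCoordHolo_eHoloAt (θ : Stage13Params F N) (ℓ : U3Letters₁₁) (hs : ℓ.Signs) (hγ0 : 0 < θ.γ)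
    (hlim : PolLimitsExistOfRecord₁₃ F N θ) {κ₅ C₅ : ℝ} (hC₅ : 0 ≤ C₅) (h5 : KernelStepRateOfRecord₁₃ F N θ κ₅ ℓ.θ₅ C₅)
    {𝔸 : Type*} [NormedRing 𝔸] [NormedAlgebra ℂ 𝔸] [CompleteSpace 𝔸] {G : Type*} [GaugeGroup G]
    (m' : ℕ) (M : ℕ) [NeZero M] (hM : M = F.L ^ m')
    (S : (K : ℕ) → ClusterTower (F.P K) 𝔸 M) (emb : ReadingMaps F (MatA N) 𝔸) (hloc : Localizes17OfRecord₁₃ F N θ S emb)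
    (Sg : (K : ℕ) → Setting 𝔸 G) (Rz : (K : ℕ) → Residual (F.P K) 𝔸) (logZ : (K : ℕ) → ℕ → GaugeField (F.P K) 0 G → ℝ) (β : ℕ → ℕ → ℝ → ℝ)
    (cs : SFConsts) (hγ : θ.γ ≤ cs.γ)
    {ϱ A R r₁ rE E₀ ρ₀ B κE κw δ₀ B₃ r : ℝ} (hϱ : 0 < ϱ) (hA : 0 ≤ A) (hr₁ : 0 ≤ r₁) (hrate : r₁ + 2 * (64 * Real.log 162) + 2 ≤ R)
    (hsmall : A * Real.exp (5 * r₁ + 1) * K₀ 64 8 * 9 * 64 ≤ 1) (hρ₀ : 0 < ρ₀) (hρ₀ϱ : ρ₀ ≤ ϱ / 2) (hρ₀E : ρ₀ ≤ rE)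
    (hBA : Real.exp 1 * 9 * 64 * K₀ 64 8 ^ 2 * A ≤ B) (hBE : E₀ ≤ B) (hE₀ : 0 ≤ E₀) (hκr : κE ≤ r₁) (hκc : κE ≤ cs.κ)
    (hκ₀ : kappa₀ (4 * 2 ^ 4) (2 * 4) ≤ κw / 2) (hκw : κw ≤ κE) (hδ₀ : 0 < δ₀) (hB₃ : 0 ≤ B₃) (hr : 0 < r)
    (hO : ∀ (K k : ℕ), ∀ g ∈ box θ.γ k, ∀ (Z : (domSys (F.P K) M (k + 1)).Dom),
      ∀ φ ∈ spaceI (Sg K) (Rz K) M (k + 1) (domSites (F.P K) M (k + 1) Z) cs.α₀ cs.α₁, ∀ i : Fin (k + 1), (i : ℕ) < k →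
      ∃ (Hc : ℂ → ℂ) (O : Set ℂ), DifferentiableOn ℂ Hc O ∧ (∀ t ∈ Ioc (0 : ℝ) θ.γ, closedBall (t : ℂ) ϱ ⊆ O) ∧
        (∀ z ∈ O, ‖Hc z‖ ≤ A * Real.exp (-(R * (domSys (F.P K) M (k + 1)).dj Z))) ∧
        (∀ t ∈ Ioc (0 : ℝ) θ.γ, Hc t = ((S K) k).H (Function.update g i t) φ Z))
    (hE : ∀ (K : ℕ), ∀ g ∈ Window θ.γ, ∀ k : ℕ, ∃ H : EHoloAt (sfTowerOfRecord (Sg K) (Rz K) M (S K) ⟨g, β K⟩ (logZ K)) cs k, H.E₀ ≤ E₀ ∧ rE ≤ H.r)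
    (Ec : ℕ → ℕ → Type*) [∀ K k, NormedAddCommGroup (Ec K k)] [∀ K k, NormedSpace ℂ (Ec K k)]
    (ι : letI := θ.instVβ₁; letI := θ.instVβ₂
      (K k : ℕ) → (domSys (F.P K) M (k + 1)).Dom → ((Fin (F.P K).d → Site (F.P K) (k + 1) → θ.Vβ) →L[ℝ] Ec K k))
    (Φ : (K k : ℕ) → (domSys (F.P K) M (k + 1)).Dom → Ec K k → CPair (F.P K) 𝔸)
    (U : (K k : ℕ) → (domSys (F.P K) M (k + 1)).Dom → Set (Ec K k)) (hU : ∀ K k X, IsOpen (U K k X)) (hrU : ∀ K k X, ball (0 : Ec K k) r ⊆ U K k X)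
    (hEhol : ∀ g ∈ Window θ.γ, ∀ (K k : ℕ) (X : (domSys (F.P K) M (k + 1)).Dom),
      DifferentiableOn ℂ (fun z => ((S K) k).E (histPrefix g k) (Φ K k X z) X) (U K k X))
    (hΦemb : letI := θ.instVβ₁; letI := θ.instVβ₂
      ∀ (K k : ℕ) (X : (domSys (F.P K) M (k + 1)).Dom) (Bf : Fin (F.P K).d → Site (F.P K) (k + 1) → θ.Vβ),
        Φ K k X (ι K k X Bf) = emb K k (fun l t => NormedSpace.exp (θ.ρ8 (Bf l t))))
    (hΦsp : ∀ (K k : ℕ) (X : (domSys (F.P K) M (k + 1)).Dom), ∀ z ∈ ball (0 : Ec K k) r, ∀ Z : (domSys (F.P K) M (k + 1)).Dom, Z.1 ⊆ X.1 →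
      Φ K k X z ∈ spaceI (Sg K) (Rz K) M (k + 1) (domSites (F.P K) M (k + 1) Z) cs.α₀ cs.α₁)
    (w : (K k : ℕ) → (domSys (F.P K) M (k + 1)).Dom → Site (F.P K) (k + 1) → ℝ) (hw₀ : ∀ K k X t, 0 ≤ w K k X t)
    (hw : letI := θ.instVβ₁; letI := θ.instVβ₂; letI := θ.instιβ
      ∀ (K k : ℕ) (X : (domSys (F.P K) M (k + 1)).Dom) (l : Fin (F.P K).d) (t : Site (F.P K) (k + 1)) (cc : θ.ιβ),
        ‖ι K k X (Pi.single l (Pi.single t (θ.bV cc)))‖ ≤ w K k X t)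
    (htail : ∀ (K k : ℕ) (X : (domSys (F.P K) M (k + 1)).Dom) (t : Site (F.P K) (k + 1)),
      let e : Site (F.P K) (k + 1) → TPt 4 (domCount (F.P K) M (k + 1) * M) := fun x i => (ZMod.cast (x i) : ZMod (domCount (F.P K) M (k + 1) * M))
      w K k X t ≤ B₃ * Real.exp (-δ₀ * distCT (domCount (F.P K) M (k + 1)) M (e t) (nearT (M := M) (e t) X)))
    (hκ₅ : delta1 δ₀ κw ((M : ℝ) * 4) ≤ κ₅) (hω : 0 < ℓ.ω) (hθω : ℓ.θ₅ ≤ ℓ.ω ^ 2) (hℓκ : ℓ.κ ≤ delta1 δ₀ κw ((M : ℝ) * 4))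
    (hC₉ : (4 * (2 * C₅ / (1 - ℓ.θ₅) +
        2 * ((16 * B * B₃ ^ 2 / r ^ 2) * Real.exp (delta1 δ₀ κw ((M : ℝ) * 4) * ((M : ℝ) * 4) * 3) * K₀ (4 * 2 ^ 4) (2 * 4) * K₁ 4 (δ₀ / 2))) / θ.γ +
        ((16 * (64 * B / ρ₀ ^ 2) * B₃ ^ 2 / r ^ 2) * Real.exp (delta1 δ₀ κw ((M : ℝ) * 4) * ((M : ℝ) * 4) * 3) * K₀ (4 * 2 ^ 4) (2 * 4) *
          K₁ 4 (δ₀ / 2)) * θ.γ / 2) / ℓ.ω ≤ ℓ.C₉) :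
    NE9 ((objectsOfRecord₁₃ F N θ ℓ).EA 0) (Window θ.γ) ℓ.κ ℓ.moduli :=
  have hB : 0 ≤ B := hE₀.trans hBE
  ne9_EA_objectsOfRecord₁₃_of_kernelStepRate_outputCoordHolo' F N θ ℓ hs hγ0 hlim hC₅ h5 m' M hM S emb hloc
    (fun K k X => {φ : CPair (F.P K) 𝔸 | ∀ Z : (domSys (F.P K) M (k + 1)).Dom, Z.1 ⊆ X.1 → φ ∈ spaceI (Sg K) (Rz K) M (k + 1) (domSites (F.P K) M (k + 1) Z) cs.α₀ cs.α₁})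
    hρ₀ hκ₀ hδ₀ hB₃ hr hB hκw
    (fun K k i => outputCoordHolo_of_olderActivityCoordHolo_eHoloAt F K (Sg K) (Rz K) (logZ K) (β K) (S K) hγ hϱ hA hr₁ hrate hsmall hρ₀ϱ hρ₀E hBA hBE hκr hκc
      (hO K) (hE K) k i)
    Ec ι Φ U hU hrU hEhol hΦemb (fun K k X z hz => hΦsp K k X z hz) w hw₀ hw htail hκ₅ hω hθω hℓκ hC₉

open Classical in
/-- ★★★ **THE N22 PIN FACE** of `ne9_EA_objectsOfRecord₁₃_of_kernelStepRate_olderActivityCoordHolo_eHoloAt` under K3⁷ v5's node-U3 pin at the tuple: `N22At (rateCarriersOfRecord₁₃CoPH 𝔯 F θ hP g₀ os k).u3`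
for EVERY run length `k` — dag-n22-w3's `n22At_rateCarriers_of_kernels_pin_of_ne9`. [folklore] -/
theorem n22At_rateCarriers_of_kernels_pin_of_kernelStepRate_olderActivityCoordHolo_eHoloAt (𝔯 : RateReading₁₃CoPH N) (θ : Stage13HParams F N)
    (hP : θ.Provisos₁₃CoPH F N) (g₀ : ℕ → ℝ) (os : List (ULoop F)) (ℓ : U3Letters₁₁) (hs : ℓ.Signs) (hγ0 : 0 < θ.γ)
    (hpin : (𝔯.lit F θ hP g₀ os).u3 = objectsOfRecord₁₃ F N θ.toStage13Params ℓ)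
    (hlim : PolLimitsExistOfRecord₁₃ F N θ.toStage13Params) {κ₅ C₅ : ℝ} (hC₅ : 0 ≤ C₅) (h5 : KernelStepRateOfRecord₁₃ F N θ.toStage13Params κ₅ ℓ.θ₅ C₅)
    {𝔸 : Type*} [NormedRing 𝔸] [NormedAlgebra ℂ 𝔸] [CompleteSpace 𝔸] {G : Type*} [GaugeGroup G]
    (m' : ℕ) (M : ℕ) [NeZero M] (hM : M = F.L ^ m')
    (S : (K : ℕ) → ClusterTower (F.P K) 𝔸 M) (emb : ReadingMaps F (MatA N) 𝔸) (hloc : Localizes17OfRecord₁₃ F N θ.toStage13Params S emb)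
    (Sg : (K : ℕ) → Setting 𝔸 G) (Rz : (K : ℕ) → Residual (F.P K) 𝔸) (logZ : (K : ℕ) → ℕ → GaugeField (F.P K) 0 G → ℝ) (β : ℕ → ℕ → ℝ → ℝ)
    (cs : SFConsts) (hγ : θ.γ ≤ cs.γ)
    {ϱ A R r₁ rE E₀ ρ₀ B κE κw δ₀ B₃ r : ℝ} (hϱ : 0 < ϱ) (hA : 0 ≤ A) (hr₁ : 0 ≤ r₁) (hrate : r₁ + 2 * (64 * Real.log 162) + 2 ≤ R)
    (hsmall : A * Real.exp (5 * r₁ + 1) * K₀ 64 8 * 9 * 64 ≤ 1) (hρ₀ : 0 < ρ₀) (hρ₀ϱ : ρ₀ ≤ ϱ / 2) (hρ₀E : ρ₀ ≤ rE)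
    (hBA : Real.exp 1 * 9 * 64 * K₀ 64 8 ^ 2 * A ≤ B) (hBE : E₀ ≤ B) (hE₀ : 0 ≤ E₀) (hκr : κE ≤ r₁) (hκc : κE ≤ cs.κ)
    (hκ₀ : kappa₀ (4 * 2 ^ 4) (2 * 4) ≤ κw / 2) (hκw : κw ≤ κE) (hδ₀ : 0 < δ₀) (hB₃ : 0 ≤ B₃) (hr : 0 < r)
    (hO : ∀ (K k : ℕ), ∀ g ∈ box θ.γ k, ∀ (Z : (domSys (F.P K) M (k + 1)).Dom),
      ∀ φ ∈ spaceI (Sg K) (Rz K) M (k + 1) (domSites (F.P K) M (k + 1) Z) cs.α₀ cs.α₁, ∀ i : Fin (k + 1), (i : ℕ) < k →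
      ∃ (Hc : ℂ → ℂ) (O : Set ℂ), DifferentiableOn ℂ Hc O ∧ (∀ t ∈ Ioc (0 : ℝ) θ.γ, closedBall (t : ℂ) ϱ ⊆ O) ∧
        (∀ z ∈ O, ‖Hc z‖ ≤ A * Real.exp (-(R * (domSys (F.P K) M (k + 1)).dj Z))) ∧
        (∀ t ∈ Ioc (0 : ℝ) θ.γ, Hc t = ((S K) k).H (Function.update g i t) φ Z))
    (hE : ∀ (K : ℕ), ∀ g ∈ Window θ.γ, ∀ k : ℕ, ∃ H : EHoloAt (sfTowerOfRecord (Sg K) (Rz K) M (S K) ⟨g, β K⟩ (logZ K)) cs k, H.E₀ ≤ E₀ ∧ rE ≤ H.r)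
    (Ec : ℕ → ℕ → Type*) [∀ K k, NormedAddCommGroup (Ec K k)] [∀ K k, NormedSpace ℂ (Ec K k)]
    (ι : letI := θ.instVβ₁; letI := θ.instVβ₂
      (K k : ℕ) → (domSys (F.P K) M (k + 1)).Dom → ((Fin (F.P K).d → Site (F.P K) (k + 1) → θ.Vβ) →L[ℝ] Ec K k))
    (Φ : (K k : ℕ) → (domSys (F.P K) M (k + 1)).Dom → Ec K k → CPair (F.P K) 𝔸)
    (U : (K k : ℕ) → (domSys (F.P K) M (k + 1)).Dom → Set (Ec K k)) (hU : ∀ K k X, IsOpen (U K k X)) (hrU : ∀ K k X, ball (0 : Ec K k) r ⊆ U K k X)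
    (hEhol : ∀ g ∈ Window θ.γ, ∀ (K k : ℕ) (X : (domSys (F.P K) M (k + 1)).Dom),
      DifferentiableOn ℂ (fun z => ((S K) k).E (histPrefix g k) (Φ K k X z) X) (U K k X))
    (hΦemb : letI := θ.instVβ₁; letI := θ.instVβ₂
      ∀ (K k : ℕ) (X : (domSys (F.P K) M (k + 1)).Dom) (Bf : Fin (F.P K).d → Site (F.P K) (k + 1) → θ.Vβ),
        Φ K k X (ι K k X Bf) = emb K k (fun l t => NormedSpace.exp (θ.ρ8 (Bf l t))))
    (hΦsp : ∀ (K k : ℕ) (X : (domSys (F.P K) M (k + 1)).Dom), ∀ z ∈ ball (0 : Ec K k) r, ∀ Z : (domSys (F.P K) M (k + 1)).Dom, Z.1 ⊆ X.1 →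
      Φ K k X z ∈ spaceI (Sg K) (Rz K) M (k + 1) (domSites (F.P K) M (k + 1) Z) cs.α₀ cs.α₁)
    (w : (K k : ℕ) → (domSys (F.P K) M (k + 1)).Dom → Site (F.P K) (k + 1) → ℝ) (hw₀ : ∀ K k X t, 0 ≤ w K k X t)
    (hw : letI := θ.instVβ₁; letI := θ.instVβ₂; letI := θ.instιβ
      ∀ (K k : ℕ) (X : (domSys (F.P K) M (k + 1)).Dom) (l : Fin (F.P K).d) (t : Site (F.P K) (k + 1)) (cc : θ.ιβ),
        ‖ι K k X (Pi.single l (Pi.single t (θ.bV cc)))‖ ≤ w K k X t)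
    (htail : ∀ (K k : ℕ) (X : (domSys (F.P K) M (k + 1)).Dom) (t : Site (F.P K) (k + 1)),
      let e : Site (F.P K) (k + 1) → TPt 4 (domCount (F.P K) M (k + 1) * M) := fun x i => (ZMod.cast (x i) : ZMod (domCount (F.P K) M (k + 1) * M))
      w K k X t ≤ B₃ * Real.exp (-δ₀ * distCT (domCount (F.P K) M (k + 1)) M (e t) (nearT (M := M) (e t) X)))
    (hκ₅ : delta1 δ₀ κw ((M : ℝ) * 4) ≤ κ₅) (hω : 0 < ℓ.ω) (hθω : ℓ.θ₅ ≤ ℓ.ω ^ 2) (hℓκ : ℓ.κ ≤ delta1 δ₀ κw ((M : ℝ) * 4))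
    (hC₉ : (4 * (2 * C₅ / (1 - ℓ.θ₅) +
        2 * ((16 * B * B₃ ^ 2 / r ^ 2) * Real.exp (delta1 δ₀ κw ((M : ℝ) * 4) * ((M : ℝ) * 4) * 3) * K₀ (4 * 2 ^ 4) (2 * 4) * K₁ 4 (δ₀ / 2))) / θ.γ +
        ((16 * (64 * B / ρ₀ ^ 2) * B₃ ^ 2 / r ^ 2) * Real.exp (delta1 δ₀ κw ((M : ℝ) * 4) * ((M : ℝ) * 4) * 3) * K₀ (4 * 2 ^ 4) (2 * 4) *
          K₁ 4 (δ₀ / 2)) * θ.γ / 2) / ℓ.ω ≤ ℓ.C₉)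
    (k : ℕ) : N22At (rateCarriersOfRecord₁₃CoPH 𝔯 F θ hP g₀ os k).u3 :=
  n22At_rateCarriers_of_kernels_pin_of_ne9 𝔯 θ hP g₀ os ℓ hs hpin
    (ne9_EA_objectsOfRecord₁₃_of_kernelStepRate_olderActivityCoordHolo_eHoloAt F N θ.toStage13Params ℓ hs hγ0 hlim hC₅ h5 m' M hM S emb hloc Sg Rz logZ β cs hγ
      hϱ hA hr₁ hrate hsmall hρ₀ hρ₀ϱ hρ₀E hBA hBE hE₀ hκr hκc hκ₀ hκw hδ₀ hB₃ hr hO hE Ec ι Φ U hU hrU hEhol hΦemb hΦsp w hw₀ hw htail hκ₅ hω hθω hℓκ hC₉) k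

end Record

end YMDAG.N22.KernelFading

end
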